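import Literature.NumberTheory.ConnesConsani2021.ArchKernelTier2Bridge
import Literature.NumberTheory.ConnesConsani2021.ArchKernelTier2H8E
import HarnessLib

/-!
# (E-a) Tier 2 — FINAL: `CC2021_section6_enclosures_holds`

RH-FREE certified numerics (cell rh-crit; consortium cc-iso g4 / t4 g4 / eng-1 / gm-t16 / t7 under cc-lead R119–R139).
The in-kernel (E-a) certificate discharges the named fact `CC2021_section6_enclosures` (the §6 enclosures
`a₀ ≤ 0.0635`, `ε′(1⁺) ≤ 23.1` of Connes–Consani 2021): data `ArchKernelTier2Panels` (2048 `v`-sub-panels, 64 Taylor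
models of degree 6, `Σ M = 19386406156870955179816431879009767195318/2¹²⁸`), kernel facts `ArchKernelTier2PanelsCheck*/Flat*`,
read-back `ArchKernelTier2PanelsSound` and — in the ∃E form of record (R138: the S₈ read-back is stated for an extension `E`
that agrees with `S₈ ∘ exp` on `[0, log 2]`, because the tree's `sonineQTerm` carries junk values at `ρ < 1`, which the radius
`hQ` of panel 0 reaches) — `ArchKernelTier2S8Sound.tier2_hM_of_exists` (t4) with the discharged instance
`ArchKernelTier2H8E.h8E_of_s8TM` (gm-t16), assembly `ArchKernelTier2Assembly.hcheck_tier2` (L¹ defect ≤ 8.81·10⁻⁴ ≤ 1/400),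
slope window `ArchKernelModesIdentified.tsum_epsSlopeTerm_prolateFun_mem_fine` (gm-t16), inside t7's frame
`ArchKernelL1Assembly.section6_enclosures_of_tier2`.  This file: the ∃E twins of the assembly at the stub family `s8Stub`
and the final composition.
WHAT THIS IS NOT: any claim about RH — an RH-FREE archimedean estimate; nothing here bears on the truth of RH.
-/

noncomputable section

open Real Set MeasureTheory
open Literature.Analysis.ValidatedNumerics.NumericsMP Literature.Analysis.ValidatedNumerics.PolyMP
open Literature.NumberTheory.ConnesConsani2021.ArchCert (S)
open Literature.NumberTheory.ConnesConsani2021.ArchCertSigma (sigmaTM hQ)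

namespace Literature.NumberTheory.ConnesConsani2021

namespace ArchCertT2

open Literature.NumberTheory.LFunctions

/-- All 64 stub models are OUTPUTS of `s8TM` (`Option` form of `s8TM_isSome`). [cite: ConnesConsani2021, §6.3 p. 24 (in-kernel (E-a) certificate)] -/
theorem s8TM_eq_some_s8Stub : ∀ K < 64, s8TM hQ 6 (centre K) combinedLit = some (s8Stub K) := by
  intro K hK
  obtain ⟨P, hP⟩ := Option.isSome_iff_exists.mp (s8TM_isSome K hK)
  have hs : s8Stub K = P := by
    unfold s8Stub
    rw [hP, Option.getD_some]
  rw [hs]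
  exact hP

/-- **The S₈ read-back of record (∃E form), fully discharged** for the stub family: for every panel `K < 64` an extension
`E` of `u ↦ S₈(e^{c_K+u})` from `c_K + u ∈ [0, log 2]` is enclosed by the Taylor model `s8Stub K`.
[cite: ConnesConsani2021, §5 eq. (99) p. 32 and §6.3 p. 24 (in-kernel (E-a) certificate)] -/
theorem h8E_s8Stub : ∀ K < 64, ∃ E : ℝ → ℝ, TMem S hQ E (s8Stub K) ∧
    ∀ u : ℝ, 0 ≤ cK K + u → cK K + u ≤ Real.log 2 → E u = S8 (Real.exp (cK K + u)) :=
  h8E_of_s8TM s8Stub s8TM_eq_some_s8Stub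

/-- **hM for the data of record from the ∃E read-back**: t7's hypothesis with `m = 2048`, `M = panelMQ`, `et = etQ`
(the ∃E twin of `tier2_hM`). [cite: ConnesConsani2021, §6.4 Fact 6.1 + Lemma 6.3 p. 24 (in-kernel (E-a) certificate); §6.3 p. 24] -/
theorem tier2_hM_E
    (h8E : ∀ K < 64, ∃ E : ℝ → ℝ, TMem S hQ E (s8Stub K) ∧
      ∀ u : ℝ, 0 ≤ cK K + u → cK K + u ≤ Real.log 2 → E u = S8 (Real.exp (cK K + u))) :
    ∀ k : ℕ, k < 2048 → ∀ w ∈ Icc ((k : ℝ) * Real.log 2 / 2048) (((k + 1 : ℕ) : ℝ) * Real.log 2 / 2048),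
      |2 * (etQ : ℝ) * (SpectralCert.frameKernel (-(Real.log 2 / 2)) (Real.log 2 / 2)
            SpectralCert.CertAF.N (fun n ↦ (SpectralCert.CertAF.c n : ℝ)) w).re
        - ∑ n ∈ Finset.range 8, sonineQTerm (prolateFun n) (prolateEigen n) (Real.exp w)|
        ≤ (panelMQ k : ℝ) := by
  have hσ : ∀ K < 64, TMem S hQ (fun u ↦ 2 * ((twoEt / 2 : ℚ) : ℝ) * (tauC (cK K + u)).re) (sigmaTM K) := by
    intro K _
    have h := ArchCertSigma.tmem_sigmaTM_et K
    rw [twoEt_div_two]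
    refine fun u hu ↦ ?_
    obtain ⟨as, has, hev⟩ := h u hu
    refine ⟨as, has, ?_⟩
    rw [← hev]
    simp only [tauC, cK, etQ]
  intro k hk w hw
  have h := tier2_hM_of_exists s8Stub hP_flat hσ h8E k hk w hw
  rw [twoEt_div_two] at h
  simpa only [tauC, S8] using h

/-- **`CC2021_section6_enclosures` from the Tier-2 certificate**, modulo the ∃E read-back and the slope window
(the ∃E twin of `section6_enclosures_of_tier2_inputs`).
[cite: ConnesConsani2021, §6.4 Fact 6.1 + Lemma 6.3 p. 24; §6.7 Lemma 6.10 / Thm. 6.11 p. 28] -/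
theorem section6_enclosures_of_h8E
    (h8E : ∀ K < 64, ∃ E : ℝ → ℝ, TMem S hQ E (s8Stub K) ∧
      ∀ u : ℝ, 0 ≤ cK K + u → cK K + u ≤ Real.log 2 → E u = S8 (Real.exp (cK K + u)))
    (he : (eloQ : ℝ) ≤ ∑' n : ℕ, epsSlopeTerm (prolateFun n) ∧ ∑' n : ℕ, epsSlopeTerm (prolateFun n) ≤ (ehiQ : ℝ)) :
    CC2021_section6_enclosures :=
  have hle : (etQ : ℝ) ≤ (eloQ : ℝ) := by
    simp only [etQ, eloQ, ArchCert.eLoNum]; norm_num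
  section6_enclosures_of_tier2 (elo := etQ) (ehi := ehiQ) (et := etQ) (m := 2048) (M := panelMQ)
    (by simp only [etQ]; norm_num) ⟨hle.trans he.1, he.2⟩
    (by simp only [ehiQ, etQ, ArchCert.eHiNum]; norm_num) (by norm_num)
    (tier2_hM_E h8E) hcheck_tier2

end ArchCertT2

open Literature.NumberTheory.LFunctions in
/-- **(E-a) DISCHARGED — Connes–Consani 2021 §6 enclosures** (`CC2021_section6_enclosures`: the window operator's
spectral constant `a₀ ≤ 0.0635` and the slope `ε′(1⁺) ≤ 23.1`), by the in-kernel Tier-2 certificate: ∃E read-back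
`ArchCertT2.h8E_s8Stub` + fine slope window `ArchCert.tsum_epsSlopeTerm_prolateFun_mem_fine` (cast by `ArchCertT2.he_of_fine`).
[cite: ConnesConsani2021, §6.4 Fact 6.1 + Lemma 6.3 p. 24; §6.7 Lemma 6.10 / Thm. 6.11 p. 28] -/
theorem CC2021_section6_enclosures_holds : CC2021_section6_enclosures :=
  ArchCertT2.section6_enclosures_of_h8E ArchCertT2.h8E_s8Stub
    (ArchCertT2.he_of_fine ArchCert.tsum_epsSlopeTerm_prolateFun_mem_fine)

end Literature.NumberTheory.ConnesConsani2021

end
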